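import Summits.CriticalPhenomena.PercolationContinuityZ3.Theorems.PercNearOneGluingNoHeavyLowerTailKNQuestion7AllRelays
import Summits.CriticalPhenomena.PercolationContinuityZ3.Theorems.PercNearOneGluingNoHeavyLowerTailOfAnchoredUnionTransfer
import HarnessLib

/-!
# `NoHeavyLowerTail` (stmt-CriticalPhenomena-4575) — the ANCHORED UNION TRANSFER (AUT-obs) for every relay set, every
# level and every weight vector, as an instance of Kozma–Nitzan's Conjecture 4 (designated form)

Support file (`--supports stmt-CriticalPhenomena-4575`), prover `prim-gen-induct` (gen 12).  No definitions, no named facts,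
no sorries; standard axioms.

The anchored union transfer of this cell's line (memo `run/shared/lean/prim/prim-gen-induct/AUT-CRUX.md`; the hypothesis of
the tree reduction `AnchoredUnionTransfer.noHeavyLowerTail_of_anchoredUnionTransfer`, p203544): for an observer `o`, an
anchor `a` and a finite relay set, IF `E F(C a) ≤ E F(C g)` for every relay `g` (for the crux: `F` = the indicator that a
cluster meets MORE than half of `A`, so the hypothesis says `a` is the relay most likely to be "light"), THEN on the event
`{o ↮ a} ∩ {o ↔ some relay g ≠ a}` the functional of the anchor's cluster is dominated by that of the observer's cluster:
`∫_{o↮a, o↔A∖a} F(C a) ≤ ∫_{o↮a, o↔A∖a} F(C o)`.  This is EXACTLY Kozma–Nitzan's Conjecture 4 in designated form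
(`Q7Psi.kn_conj4_designated`, prim-cplus-coupling p205700, itself from the conditioned slack hierarchy `CSH.cshAll`, p205010)
for the relay set `A ∋ a` with designated relay `a`, after discarding the event `{o ↔ a}` on which the two clusters coincide.

* `AnchoredUnionTransfer.aut_real` — the real-functional form above (every monotone `F : Set (Fin n) → ℝ`);
* `AnchoredUnionTransfer.aut_obs` — the level form used by the crux reduction: with `light v := 2·#{x ∈ A | v ↔ x} ≤ |A|`,
  `μ(light g) ≤ μ(light a)` for all `g ∈ A` implies `μ(o↮a, o↔A∖a, light o) ≤ μ(o↮a, o↔A∖a, light a)` — verbatim the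
  hypothesis `hAUT` of `noHeavyLowerTail_of_anchoredUnionTransfer`; the closing `example` re-derives `NoHeavyLowerTail`
  along this cell's ladder (crux ⟸ CIL ⟸ AUT-obs ⟸ KN Conj. 4 ⟸ CSH), a second path next to `CSH.noHeavyLowerTail_holds`.
Census record of AUT-obs before this proof: n = 6 exhaustive 0 / 34 063 854 anchored checks, 0 / 268 546 957 sub-relay-set
checks (kit j081619–22), random n ≤ 9 0 / 43 702 (j083090).
[cite: KozmaNitzan2024, Conjecture 4 (p. 32), Question 7 (p. 36), Lemma 2 (p. 6)]
-/

noncomputable section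

namespace Summit.CriticalPhenomena.PercolationContinuityZ3.Theorems

open MeasureTheory Set Literature.Probability.LatticeModels Literature.Probability.Percolation
open Summit.CriticalPhenomena.PercolationContinuityZ3.Theses.PercNearOneGluing
open scoped Classical

namespace AnchoredUnionTransfer

variable {n : ℕ}

/-- The union event `{o ↔ A}` splits into `{o ↔ a}` and `{o ↮ a} ∩ {o ↔ some g ∈ A, g ≠ a}` when `a ∈ A`. [folklore] -/
theorem iUnion_openConn_eq_union (A : Finset (Fin n)) (o a : Fin n) (ha : a ∈ A) :
    (⋃ g ∈ A, (openConn o g : Set (BondConfig (Fin n)))) =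
      openConn o a ∪ ({ω : BondConfig (Fin n) | ¬ (openGraph ω).Reachable o a} ∩
        {ω | ∃ g ∈ A, g ≠ a ∧ (openGraph ω).Reachable o g}) := by
  ext ω
  simp only [mem_iUnion, mem_union, mem_inter_iff, mem_setOf_eq, exists_prop, openConn]
  constructor
  · rintro ⟨g, hg, hog⟩
    by_cases hoa : (openGraph ω).Reachable o a
    · exact Or.inl hoa
    · exact Or.inr ⟨hoa, g, hg, fun hga => hoa (hga ▸ hog), hog⟩
  · rintro (hoa | ⟨_, g, hg, _, hog⟩)
    · exact ⟨a, ha, hoa⟩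
    · exact ⟨g, hg, hog⟩

/-- **AUT for a real monotone cluster functional** (all weights, all relay sets).  If the anchor `a ∈ A` has the least mean
`E F(C a) ≤ E F(C g)` (`g ∈ A`), then `∫_{o↮a, o↔A∖a} F(C a) ≤ ∫_{o↮a, o↔A∖a} F(C o)`.  (Kozma–Nitzan Conjecture 4, designated
form `Q7Psi.kn_conj4_designated`, minus the event `{o↔a}` on which `C o = C a`.) [cite: KozmaNitzan2024, Conjecture 4 (p. 32)] -/
theorem aut_real (w : Sym2 (Fin n) → unitInterval) (A : Finset (Fin n)) (o a : Fin n) (ha : a ∈ A)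
    (F : Set (Fin n) → ℝ) (hF : ∀ S T : Set (Fin n), S ⊆ T → F S ≤ F T)
    (hmin : ∀ g ∈ A, ∫ ω, F (openCluster ω a) ∂(prodBernoulli w) ≤ ∫ ω, F (openCluster ω g) ∂(prodBernoulli w)) :
    ∫ ω in {ω : BondConfig (Fin n) | ¬ (openGraph ω).Reachable o a} ∩
        {ω | ∃ g ∈ A, g ≠ a ∧ (openGraph ω).Reachable o g}, F (openCluster ω a) ∂(prodBernoulli w) ≤
      ∫ ω in {ω : BondConfig (Fin n) | ¬ (openGraph ω).Reachable o a} ∩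
        {ω | ∃ g ∈ A, g ≠ a ∧ (openGraph ω).Reachable o g}, F (openCluster ω o) ∂(prodBernoulli w) := by
  set μ := prodBernoulli w with hμ
  set Oa : Set (BondConfig (Fin n)) := openConn o a with hOa
  set R : Set (BondConfig (Fin n)) := {ω : BondConfig (Fin n) | ¬ (openGraph ω).Reachable o a} ∩
    {ω | ∃ g ∈ A, g ≠ a ∧ (openGraph ω).Reachable o g} with hR
  have hmeas : ∀ s : Set (BondConfig (Fin n)), MeasurableSet s := fun _ => MeasurableSet.of_discrete
  have hint : ∀ (f : BondConfig (Fin n) → ℝ) (s : Set (BondConfig (Fin n))), IntegrableOn f s μ :=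
    fun f s => (Integrable.of_finite).integrableOn
  have hdisj : Disjoint Oa R := by
    rw [Set.disjoint_left]
    rintro ω hoa ⟨hnot, _⟩
    exact hnot hoa
  -- Conjecture 4 (designated) on `{o ↔ A}`, split along `{o ↔ a}`
  have key := Q7Psi.kn_conj4_designated w A o a F hF ha hmin
  rw [iUnion_openConn_eq_union A o a ha] at key
  change ∫ ω in Oa ∪ R, F (openCluster ω a) ∂μ ≤ ∫ ω in Oa ∪ R, F (openCluster ω o) ∂μ at key
  rw [setIntegral_union hdisj (hmeas R) (hint _ _) (hint _ _),
    setIntegral_union hdisj (hmeas R) (hint _ _) (hint _ _)] at key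
  -- on `{o ↔ a}` the two clusters coincide
  have hsame : ∫ ω in Oa, F (openCluster ω a) ∂μ = ∫ ω in Oa, F (openCluster ω o) ∂μ :=
    setIntegral_congr_fun (hmeas Oa) fun ω hω => by
      rw [KNPreFKG.openCluster_eq_of_reachable (hω : (openGraph ω).Reachable o a)]
  rw [hsame] at key
  linarith

/-- The level-`|A|/2` heaviness indicator of a vertex set: `0` if it meets at most half of `A`, else `1`. [folklore] -/
theorem heavy_mono (A : Finset (Fin n)) :
    ∀ S T : Set (Fin n), S ⊆ T →
      (fun U : Set (Fin n) => if 2 * (A.filter fun x => x ∈ U).card ≤ A.card then (0 : ℝ) else 1) S ≤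
        (fun U : Set (Fin n) => if 2 * (A.filter fun x => x ∈ U).card ≤ A.card then (0 : ℝ) else 1) T := by
  intro S T hST
  have hcard : (A.filter fun x => x ∈ S).card ≤ (A.filter fun x => x ∈ T).card :=
    Finset.card_le_card fun x hx => by
      rw [Finset.mem_filter] at hx ⊢
      exact ⟨hx.1, hST hx.2⟩
  simp only
  by_cases hT : 2 * (A.filter fun x => x ∈ T).card ≤ A.card
  · have hS : 2 * (A.filter fun x => x ∈ S).card ≤ A.card := by omega
    rw [if_pos hS, if_pos hT]
  · rw [if_neg hT]
    split_ifs <;> norm_num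

/-- The heaviness indicator read on the cluster of `v`, integrated over an event `E`, is `μ(E) − μ(E ∩ {v light})`. [folklore] -/
theorem setIntegral_heavy_eq (w : Sym2 (Fin n) → unitInterval) (A : Finset (Fin n)) (v : Fin n)
    (E : Set (BondConfig (Fin n))) :
    ∫ ω in E, (fun U : Set (Fin n) => if 2 * (A.filter fun x => x ∈ U).card ≤ A.card then (0 : ℝ) else 1)
        (openCluster ω v) ∂(prodBernoulli w) =
      (prodBernoulli w).real E -
        (prodBernoulli w).real (E ∩ {ω | 2 * (A.filter fun x => ω ∈ openConn v x).card ≤ A.card}) := by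
  set μ := prodBernoulli w with hμ
  set L : Set (BondConfig (Fin n)) := {ω | 2 * (A.filter fun x => ω ∈ openConn v x).card ≤ A.card} with hL
  have hmeas : ∀ s : Set (BondConfig (Fin n)), MeasurableSet s := fun _ => MeasurableSet.of_discrete
  have e : (fun ω : BondConfig (Fin n) =>
      (fun U : Set (Fin n) => if 2 * (A.filter fun x => x ∈ U).card ≤ A.card then (0 : ℝ) else 1) (openCluster ω v)) =
      Lᶜ.indicator 1 := by
    funext ω
    have hfilt : (A.filter fun x => x ∈ openCluster ω v) = A.filter fun x => ω ∈ openConn v x := by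
      rfl
    by_cases hω : ω ∈ L
    · have : 2 * (A.filter fun x => x ∈ openCluster ω v).card ≤ A.card := by rw [hfilt]; exact hω
      rw [Set.indicator_of_notMem (fun h => (Set.mem_compl_iff L ω).1 h hω)]
      simp only [this, if_true]
    · have : ¬ 2 * (A.filter fun x => x ∈ openCluster ω v).card ≤ A.card := by rw [hfilt]; exact hω
      rw [Set.indicator_of_mem ((Set.mem_compl_iff L ω).2 hω), Pi.one_apply]
      simp only [this, if_false]
  rw [e, integral_indicator_one (hmeas _), measureReal_restrict_apply (hmeas _)]
  have hsplit := measureReal_inter_add_sdiff (μ := μ) (s := E) (hmeas L)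
  rw [Set.inter_comm Lᶜ E, ← Set.sdiff_eq]
  linarith

/-- **AUT-obs — the anchored union transfer at level `|A|/2`, for every relay set and every weight vector**: verbatim the
hypothesis `hAUT` of `noHeavyLowerTail_of_anchoredUnionTransfer`.  With `light v := 2·#{x ∈ A | v ↔ x} ≤ |A|`: if `a ∈ A`,
`o ∉ A` and `μ(light g) ≤ μ(light a)` for all `g ∈ A`, then `μ(o↮a, o↔A∖a, light o) ≤ μ(o↮a, o↔A∖a, light a)`.
(`aut_real` for the heaviness indicator.) [cite: KozmaNitzan2024, Conjecture 4 (p. 32), Lemma 2 (p. 6)] -/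
theorem aut_obs : ∀ (n : ℕ) (w : Sym2 (Fin n) → unitInterval) (A : Finset (Fin n)) (o a : Fin n),
      a ∈ A → o ∉ A →
      (∀ g ∈ A, (prodBernoulli w).real {ω : BondConfig (Fin n) |
          2 * (A.filter fun x => ω ∈ openConn g x).card ≤ A.card} ≤
        (prodBernoulli w).real {ω : BondConfig (Fin n) |
          2 * (A.filter fun x => ω ∈ openConn a x).card ≤ A.card}) →
      (prodBernoulli w).real ({ω : BondConfig (Fin n) | ¬ (openGraph ω).Reachable o a} ∩
          {ω | ∃ g ∈ A, g ≠ a ∧ (openGraph ω).Reachable o g} ∩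
          {ω | 2 * (A.filter fun x => ω ∈ openConn o x).card ≤ A.card}) ≤
        (prodBernoulli w).real ({ω : BondConfig (Fin n) | ¬ (openGraph ω).Reachable o a} ∩
          {ω | ∃ g ∈ A, g ≠ a ∧ (openGraph ω).Reachable o g} ∩
          {ω | 2 * (A.filter fun x => ω ∈ openConn a x).card ≤ A.card}) := by
  intro n w A o a ha _ hlight
  set μ := prodBernoulli w with hμ
  set F : Set (Fin n) → ℝ := fun U => if 2 * (A.filter fun x => x ∈ U).card ≤ A.card then (0 : ℝ) else 1 with hFdef
  set R : Set (BondConfig (Fin n)) := {ω : BondConfig (Fin n) | ¬ (openGraph ω).Reachable o a} ∩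
    {ω | ∃ g ∈ A, g ≠ a ∧ (openGraph ω).Reachable o g} with hR
  -- least mean: `E F(C g) = 1 − μ(light g)`
  have hmean : ∀ v : Fin n, ∫ ω, F (openCluster ω v) ∂μ =
      1 - μ.real {ω | 2 * (A.filter fun x => ω ∈ openConn v x).card ≤ A.card} := by
    intro v
    have h := setIntegral_heavy_eq w A v Set.univ
    rw [Measure.restrict_univ] at h
    rw [hFdef, h, probReal_univ, Set.univ_inter]
  have hmin : ∀ g ∈ A, ∫ ω, F (openCluster ω a) ∂μ ≤ ∫ ω, F (openCluster ω g) ∂μ := by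
    intro g hg
    rw [hmean a, hmean g]
    linarith [hlight g hg]
  have key := aut_real w A o a ha F (heavy_mono A) hmin
  rw [hFdef, setIntegral_heavy_eq w A a R, setIntegral_heavy_eq w A o R] at key
  linarith

/-- The cell's ladder closes: `NoHeavyLowerTail` (stmt-CriticalPhenomena-4575) along crux ⟸ cumulative isolation ⟸ AUT-obs
⟸ Kozma–Nitzan Conjecture 4 ⟸ CSH — a second derivation next to `CSH.noHeavyLowerTail_holds` (p205010), recorded as an
`example` (the statement is already a tree theorem). -/
example : NoHeavyLowerTail := noHeavyLowerTail_of_anchoredUnionTransfer aut_obs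

end AnchoredUnionTransfer

end Summit.CriticalPhenomena.PercolationContinuityZ3.Theorems

end
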